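import Literature.AlgebraicGeometry.Frobenioids.ArithmeticFrobenioidThm64iiiBinders
import Literature.AlgebraicGeometry.Frobenioids.ArithmeticRealificationInstanceDelta
import Literature.AlgebraicGeometry.Frobenioids.ArithmeticRealificationFrobeniusTrivial
import Literature.AlgebraicGeometry.Frobenioids.ArithmeticRealificationPicPull
import HarnessLib

/-!
# Frobenioids I, Theorem 6.4 (iii) for an ARBITRARY `Ψ′ : (C₁^pf)^un-tr ⥲ (C₂^pf)^un-tr` — the schema `Thm64iii`
# from the DEGREE READING of the perfected divisor transport (row «T64iii-ARBITRARY-Ψ′», piece (G3))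

Mochizuki, *The geometry of Frobenioids I: the general theory*, Kyushu J. Math. **62** (2008) 293–400, §6,
Thm. 6.4 (iii), kurims pp. 114–115 ("if `Ψ^rlf` arises from an equivalence `Ψ′ : (C₁^pf)^un-tr ⥲ (C₂^pf)^un-tr`, then
`deg(Ψ^rlf) ∈ ℚ_{>0}` … the bijection `V(L₁) ⥲ Prime(Φ₁(L₁)) ⥲ Prime(Φ₂(L₂)) ⥲ V(L₂)` induced by `Ψ′` maps a
valuation lying over `v₀ ∈ V(ℚ)` to a valuation lying over `v₀`"), proof p. 116 l. 4–16 ("(ii) applied to the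
generator class … commensurability [Lemma 6.5]"). [cite: MochizukiFrdI2008, Thm. 6.4 (iii) p.114]

PROOF-ONLY file (cell abc-iut, seat abc-iut-L1-d9; L1-lead R129 (1) piece (G3); assembler of record abc-iut-L1-t3;
0 `def`, no instance, no notation, no named fact).  The schema `Thm64iii R₁ R₂ Ψrlf picMap deg u₁ u₂ Ψ′ A₁ placeMap`
(abc-iut-L1-t3) reads the base fields `L₁ := (R₁.ops.base.obj (u₁.obj A₁)).L`, `L₂ := (R₂.ops.base.obj (u₂.obj
(Ψ′.functor.obj A₁))).L`.  This lineage's `thm64iii_of_classMaps` (p424916) derives the schema from a perfected divisor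
transport `θ : Φ(L₁)^pf ⥲ Φ(L₂)^pf` and CLASS MAPS AT `u₁ A₁` — but for `U₁ = (C₁^pf)^un-tr` and an arbitrary
`A₁ = (X, γ)` the image `u₁ A₁ = (X, ι γ)` is NOT Frobenius-trivial in `C₁^rlf` (unless `deg γ = 0`), so the schema's
`δ_{u₁ A₁}` is not available there.  This file therefore provides:

* §1 `thm64iii_of_classMaps_at` — GENERIC (any `ArithRealification`s): the same derivation with the class maps at a
  FREE Frobenius-trivial pair `(A, Ψrlf A)`; only the domains of the class maps are tied to `L₁`, `L₂`;
* §2 AT THE DATA `R_i := arithRealification hΦ_i` (abc-iut-L1-d2): `thm64iii_arith_of_degreeReading` — the schema for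
  EVERY `deg`, from `θ`, a prime-compatible `placeMap`, a Frobenius-triviality witness for `Ψrlf (L₁, 0)` and ONE
  degree-level hypothesis `hdeg` ("`δ_{Ψrlf (L₁,0)}(picMap [ι₁^{pf→rlf} x]) = d_{L₂}(ι₂^{pf→rlf}(θ x))`" — which the
  assembler obtains from Thm. 6.4 (ii)'s class-map identity (abc-iut-L6-t10) and the transport compatibility (G2)
  (abc-iut-L1-d2) read in degrees); the schema's `Thm64iiDeg` antecedent at the Frobenius-trivial pair
  `((L₁, 0), Ψrlf (L₁, 0))` then yields the degree compatibility `d₂(θ x) = deg · d₁(x)` and this lineage's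
  `thm64iii_of_primeTransport` closes; `exists_placeMap_of_pfTransport` supplies THE `placeMap` of a `θ`;
* §3 the shape-independent degree services the knit needs: `FinSubextCat.finrank_along_eq_one_of_iso`,
  `ArithRlfPic.rlfDegree_rlfMap_of_iso` (THE degree `d_L` is invariant under `Φ^rlf(γ)` for an ISOMORPHISM `γ` of
  the base — kills the base-iso pull-backs of (G2)), `arithRealification_δ_picPull_of_iso` (`δ ∘ Pic(γ) = δ` for an
  iso `γ`), and `Perfection.degree_eq_rlfDegree_comp` (any `ℝ`-valued degree on `Φ(L)^pf` extending `deg^arith_L`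
  is `d_L ∘ ι^{pf→rlf}` — so abc-iut-L1-d1's / abc-iut-L1-d2's degree clauses may be phrased with either).
Nothing here bears on [IUTchIII] Cor. 3.12; no statement of the paper is strengthened; typed ≠ proved elsewhere.
-/

noncomputable section

open scoped NNReal

namespace Literature.AlgebraicGeometry.Frobenioids

open CategoryTheory Opposite Function NumberField EffArithDivisor

universe v u

/-! ### §1 The schema from class maps at a FREE Frobenius-trivial pair (generic) -/

section Generic

variable {F₁ : Type} [Field F₁] [NumberField F₁] {K₁ : Type} [Field K₁] [Algebra F₁ K₁]
variable {F₂ : Type} [Field F₂] [NumberField F₂] {K₂ : Type} [Field K₂] [Algebra F₂ K₂]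
variable {Rlf₁ : Type u} [Category.{v} Rlf₁] {Rlf₂ : Type u} [Category.{v} Rlf₂]
variable (R₁ : ArithRealification (F := F₁) (K := K₁) Rlf₁) (R₂ : ArithRealification (F := F₂) (K := K₂) Rlf₂)

/-- **Theorem 6.4 (iii) AS TYPED from class maps at a free Frobenius-trivial pair.**  As this lineage's
`thm64iii_of_classMaps` (the antecedent `Thm64iiDeg` "applied to the generator class", proof p. 116), but with THE
class maps `cl₁ : Φ(L₁)^pf → Pic_Φ(A)`, `cl₂ : Φ(L₂)^pf → Pic_Φ(Ψrlf A)` at ANY Frobenius-trivial object `A` of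
`C₁^rlf` whose image is Frobenius-trivial — `A` need not be `u₁ A₁` (which for `U₁ = (C₁^pf)^un-tr` is in general
NOT Frobenius-trivial); only the domains of `cl_i` are the schema's `Φ(L_i)^pf`.
[cite: MochizukiFrdI2008, Thm. 6.4 (iii) p.116] -/
theorem thm64iii_of_classMaps_at (Ψ : Rlf₁ ≌ Rlf₂)
    (picMap : ∀ A : Rlf₁, R₁.Pic A ≃+ R₂.Pic (Ψ.functor.obj A)) (deg : ℝ)
    {U₁ : Type u} [Category.{v} U₁] {U₂ : Type u} [Category.{v} U₂]
    (u₁ : U₁ ⥤ Rlf₁) (u₂ : U₂ ⥤ Rlf₂) (Ψ' : U₁ ≌ U₂) (A₁ : U₁)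
    (placeMap : Places (R₁.ops.base.obj (u₁.obj A₁)).L ≃
      Places (R₂.ops.base.obj (u₂.obj (Ψ'.functor.obj A₁))).L)
    (θ : Perfection (Multiplicative (EffArithDivisor (R₁.ops.base.obj (u₁.obj A₁)).L)) ≃*
      Perfection (Multiplicative (EffArithDivisor (R₂.ops.base.obj (u₂.obj (Ψ'.functor.obj A₁))).L)))
    (hθ : ∀ v : Places (R₁.ops.base.obj (u₁.obj A₁)).L,
      Primes.congr θ (Quotient.mk (primarySetoid _) ⟨_, EffArithDivisor.isPrimary_of_single _ v⟩) =
        Quotient.mk (primarySetoid _) ⟨_, EffArithDivisor.isPrimary_of_single _ (placeMap v)⟩)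
    (A : Rlf₁) (hA : R₁.ops.IsFrobeniusTrivial A) (hA' : R₂.ops.IsFrobeniusTrivial (Ψ.functor.obj A))
    (cl₁ : Perfection (Multiplicative (EffArithDivisor (R₁.ops.base.obj (u₁.obj A₁)).L)) →*
      Multiplicative (R₁.Pic A))
    (cl₂ : Perfection (Multiplicative (EffArithDivisor (R₂.ops.base.obj (u₂.obj (Ψ'.functor.obj A₁))).L)) →*
      Multiplicative (R₂.Pic (Ψ.functor.obj A)))
    (hcl₁ : ∀ D, R₁.δ _ hA (Multiplicative.toAdd (cl₁ (Perfection.of _ (Multiplicative.ofAdd D)))) =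
      arithDegree _ (toArithDivisor _ D))
    (hcl₂ : ∀ D, R₂.δ _ hA' (Multiplicative.toAdd (cl₂ (Perfection.of _ (Multiplicative.ofAdd D)))) =
      arithDegree _ (toArithDivisor _ D))
    (hθcl : ∀ x, picMap _ (Multiplicative.toAdd (cl₁ x)) = Multiplicative.toAdd (cl₂ (θ x))) :
    Thm64iii R₁ R₂ Ψ picMap deg u₁ u₂ Ψ' A₁ placeMap := by
  intro hT h1
  refine thm64iii_of_primeTransport R₁ R₂ Ψ picMap deg u₁ u₂ Ψ' A₁ placeMap θ hθ
    ((R₁.δ _ hA).toAddMonoidHom.toMultiplicative.comp cl₁) ((R₂.δ _ hA').toAddMonoidHom.toMultiplicative.comp cl₂)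
    (fun D => hcl₁ D) (fun D => hcl₂ D) (fun x => ?_) hT h1
  change R₂.δ _ hA' (Multiplicative.toAdd (cl₂ (θ x))) = deg * R₁.δ _ hA (Multiplicative.toAdd (cl₁ x))
  rw [← hθcl, hT.2]

end Generic

/-! ### §3 Degree services at THE data (stated first; used in §2 and by the knit) -/

section Services

variable {F : Type} [Field F] [NumberField F] {K : Type} [Field K] [Algebra F K]

/-- **Along an ISOMORPHISM of `D = FinSubextCat F K` the relative degree is `1`**: `[L_X : L_Y] = 1` along `γ.hom`
for `γ : X ≅ Y` (tower law both ways). [cite: MochizukiFrdI2008, Ex. 6.3 p.113] -/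
theorem FinSubextCat.finrank_along_eq_one_of_iso {X Y : FinSubextCat F K} (γ : X ≅ Y) :
    (letI := γ.hom.toAlgHom.toRingHom.toAlgebra; Module.finrank Y.L X.L) = 1 := by
  have h₁ := FinSubextCat.finrank_eq_finrank_mul_finrank_along γ.hom
  have h₂ := FinSubextCat.finrank_eq_finrank_mul_finrank_along γ.inv
  have hX : 0 < Module.finrank F X.L := Module.finrank_pos
  -- `[X:F] = [Y:F]·a`, `[Y:F] = [X:F]·b` with `a, b ≥ 1` force `a = 1`
  set a := (letI := γ.hom.toAlgHom.toRingHom.toAlgebra; Module.finrank Y.L X.L) with ha_def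
  set b := (letI := γ.inv.toAlgHom.toRingHom.toAlgebra; Module.finrank X.L Y.L) with hb_def
  have key : Module.finrank F X.L * 1 = Module.finrank F X.L * (b * a) := by
    rw [mul_one, ← mul_assoc, ← h₂, ← h₁]
  have hab : b * a = 1 := (Nat.eq_of_mul_eq_mul_left hX key).symm
  exact Nat.eq_one_of_mul_eq_one_left hab

variable (hΦ : PreFrobenioid.IsPerfFactorialOn (arithDivisorFunctor F K))

/-- **THE degree `d_L` is invariant under the pull-back along an isomorphism of the base**: for `γ : X ≅ Y` in `D`
and `a ∈ Φ(L_Y)^rlf`, `d_X(Φ^rlf(γ) a) = d_Y(a)` (abc-iut-L1-d2's `arith_rlfDegree_comp_rlfMap`: the factor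
`[L_X : L_Y]` is `1`). [cite: MochizukiFrdI2008, Thm. 6.4 (i) p.115] -/
theorem ArithRlfPic.rlfDegree_rlfMap_of_iso {X Y : FinSubextCat F K} (γ : X ≅ Y)
    (a : (PreFrobenioid.IsPerfFactorialOn.op hΦ (op Y)).Rlf) :
    ArithRlfPic.rlfDegree hΦ X
        (Literature.AnabelianGeometry.EtaleTheta.rlfMap (arithDivisorFunctor F K)
          (PreFrobenioid.IsPerfFactorialOn.op hΦ) γ.hom.op a) =
      ArithRlfPic.rlfDegree hΦ Y a := by
  rw [ArithRlfPic.arith_rlfDegree_comp_rlfMap hΦ γ.hom (ArithRlfPic.rlfDegree hΦ X) (ArithRlfPic.rlfDegree_iota hΦ X)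
    (ArithRlfPic.rlfDegree hΦ Y) (ArithRlfPic.rlfDegree_iota hΦ Y) a, FinSubextCat.finrank_along_eq_one_of_iso γ,
    pow_one]

/-- **`δ_A ∘ Pic(γ) = δ_B` for a base ISOMORPHISM `γ : Base A ≅ Base B`** (abc-iut-L1-d2's
`arithRealification_δ_picPull`: the factor `[L_A : L_B]` is `1`). [cite: MochizukiFrdI2008, Thm. 6.4 (ii) p.114] -/
theorem arithRealification_δ_picPull_of_iso
    (A B : PreFrobenioid.rlf (ModelFrobenioid.toElem (arithDivisorFunctor F K) (unitsFunctor F K) (divNatTrans F K)) hΦ)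
    (hA : (arithRealification hΦ).ops.IsFrobeniusTrivial A) (hB : (arithRealification hΦ).ops.IsFrobeniusTrivial B)
    (γ : A.base ≅ B.base) (x : (arithRealification hΦ).Pic B) :
    (arithRealification hΦ).δ A hA (Additive.ofMul
      (((RealificationData.canonical (arithDivisorFunctor F K) (PreFrobenioid.IsPerfFactorialOn.op hΦ)).realSpan
        (PreFrobenioid.biratSubfunctor
          (ModelFrobenioid.toElem (arithDivisorFunctor F K) (unitsFunctor F K) (divNatTrans F K)))).picPull γ.hom
        (Additive.toMul x))) =
      (arithRealification hΦ).δ B hB x := by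
  rw [arithRealification_δ_picPull hΦ A hA B hB γ.hom x, FinSubextCat.finrank_along_eq_one_of_iso γ, Nat.cast_one,
    one_mul]

/-- **Uniqueness of the degree on the perfection**: an `ℝ`-valued homomorphism `d` on `Φ(L)^pf` which is
`deg^arith_L` on `Φ(L)` is THE degree `d_L ∘ ι^{pf→rlf}` read in `ℝ` (`n`-th roots are unique in `(ℝ, +)`).
[cite: MochizukiFrdI2008, Thm. 6.4 (i) p.115] -/
theorem Perfection.degree_eq_rlfDegree_comp (X : FinSubextCat F K)
    (d : Perfection (Multiplicative (EffArithDivisor X.L)) →* Multiplicative ℝ)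
    (hd : ∀ D, Multiplicative.toAdd (d (Perfection.of _ (Multiplicative.ofAdd D))) =
      arithDegree _ (toArithDivisor _ D)) :
    d = (NNReal.toRealHom.toAddMonoidHom.toMultiplicative : Multiplicative ℝ≥0 →* Multiplicative ℝ).comp
      ((ArithRlfPic.rlfDegree hΦ X).comp (PreFrobenioid.IsPerfFactorialOn.op hΦ (op X)).toRealification) := by
  refine Perfection.hom_real_ext_of fun a => ?_
  apply Multiplicative.toAdd.injective
  rw [← ofAdd_toAdd a, hd]
  exact (ArithRlfPic.rlfDegree_iota hΦ X (Multiplicative.toAdd a)).symm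

end Services

/-! ### §2 AT THE DATA: the schema from the degree reading of `picMap ∘ [ι₁^{pf→rlf} ·]` -/

section AtData

variable {F₁ : Type} [Field F₁] [NumberField F₁] {K₁ : Type} [Field K₁] [Algebra F₁ K₁]
  {F₂ : Type} [Field F₂] [NumberField F₂] {K₂ : Type} [Field K₂] [Algebra F₂ K₂]
  (hΦ₁ : PreFrobenioid.IsPerfFactorialOn (arithDivisorFunctor F₁ K₁))
  (hΦ₂ : PreFrobenioid.IsPerfFactorialOn (arithDivisorFunctor F₂ K₂))

/-- **THE bijection of places of a perfected divisor transport** `θ : Φ(L₁)^pf ⥲ Φ(L₂)^pf` between the base fields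
the schema reads (this lineage's / abc-iut-L6-t10's `exists_placesEquiv_of_mulEquiv`, re-typed at the schema's
fields): `Prime(θ)[δ_v] = [δ_{placeMap v}]`; it is unique (`placeMap_eq_of_primeTransport`).
[cite: MochizukiFrdI2008, Thm. 6.4 (iii) p.114] -/
theorem exists_placeMap_of_pfTransport
    {U₁ : Type} [Category.{0} U₁] {U₂ : Type} [Category.{0} U₂]
    (u₁ : U₁ ⥤ PreFrobenioid.rlf (ModelFrobenioid.toElem (arithDivisorFunctor F₁ K₁) (unitsFunctor F₁ K₁)
      (divNatTrans F₁ K₁)) hΦ₁)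
    (u₂ : U₂ ⥤ PreFrobenioid.rlf (ModelFrobenioid.toElem (arithDivisorFunctor F₂ K₂) (unitsFunctor F₂ K₂)
      (divNatTrans F₂ K₂)) hΦ₂)
    (Ψ' : U₁ ≌ U₂) (A₁ : U₁)
    (θ : Perfection (Multiplicative (EffArithDivisor ((arithRealification hΦ₁).ops.base.obj (u₁.obj A₁)).L)) ≃*
      Perfection (Multiplicative (EffArithDivisor
        ((arithRealification hΦ₂).ops.base.obj (u₂.obj (Ψ'.functor.obj A₁))).L))) :
    ∃ placeMap : Places ((arithRealification hΦ₁).ops.base.obj (u₁.obj A₁)).L ≃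
        Places ((arithRealification hΦ₂).ops.base.obj (u₂.obj (Ψ'.functor.obj A₁))).L,
      ∀ v, Primes.congr θ (Quotient.mk (primarySetoid _) ⟨_, EffArithDivisor.isPrimary_of_single _ v⟩) =
        Quotient.mk (primarySetoid _) ⟨_, EffArithDivisor.isPrimary_of_single _ (placeMap v)⟩ := by
  obtain ⟨π, hπ, -, -⟩ := exists_placesEquiv_of_mulEquiv _ _ θ
  exact ⟨π, hπ⟩

/-- **[FrdI] Theorem 6.4 (iii) AS TYPED (`Thm64iii`), AT THE CONSTRUCTIONS, for an ARBITRARY `Ψ′` — degree form.**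
`R_i := arithRealification hΦ_i`; `Ψrlf`, `picMap`, the comparison functors `u_i`, `Ψ′`, `A₁` arbitrary; `L₁`, `L₂`
the base fields the schema reads; `θ : Φ(L₁)^pf ⥲ Φ(L₂)^pf` a perfected divisor transport with THE `placeMap`
(`hθ`); `(L₁, 0)` is Frobenius-trivial (abc-iut-L1-t3) and `hA'` says so is `Ψrlf (L₁, 0)`.  GIVEN the degree
reading `hdeg : δ_{Ψrlf (L₁,0)}(picMap [ι₁^{pf→rlf} x]) = d_{L₂}(ι₂^{pf→rlf}(θ x))` for all `x ∈ Φ(L₁)^pf` (= Thm. 6.4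
(ii)'s class-map identity + the transport compatibility through the square, read in degrees), the schema holds for
EVERY `deg`: its antecedent `Thm64iiDeg … deg` at the pair `((L₁,0), Ψrlf (L₁,0))` gives `d₂(θ x) = deg · d₁(x)`
(`δ[ι a] = d_L(a)`, abc-iut-L1-d2), whence `deg ∈ ℚ_{>0}` and the place clauses (`thm64iii_of_primeTransport`).
[cite: MochizukiFrdI2008, Thm. 6.4 (iii) p.116] -/
theorem thm64iii_arith_of_degreeReading
    (Ψrlf : PreFrobenioid.rlf (ModelFrobenioid.toElem (arithDivisorFunctor F₁ K₁) (unitsFunctor F₁ K₁)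
        (divNatTrans F₁ K₁)) hΦ₁ ≌
      PreFrobenioid.rlf (ModelFrobenioid.toElem (arithDivisorFunctor F₂ K₂) (unitsFunctor F₂ K₂)
        (divNatTrans F₂ K₂)) hΦ₂)
    (picMap : ∀ A, (arithRealification hΦ₁).Pic A ≃+ (arithRealification hΦ₂).Pic (Ψrlf.functor.obj A))
    (deg : ℝ)
    {U₁ : Type} [Category.{0} U₁] {U₂ : Type} [Category.{0} U₂]
    (u₁ : U₁ ⥤ PreFrobenioid.rlf (ModelFrobenioid.toElem (arithDivisorFunctor F₁ K₁) (unitsFunctor F₁ K₁)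
      (divNatTrans F₁ K₁)) hΦ₁)
    (u₂ : U₂ ⥤ PreFrobenioid.rlf (ModelFrobenioid.toElem (arithDivisorFunctor F₂ K₂) (unitsFunctor F₂ K₂)
      (divNatTrans F₂ K₂)) hΦ₂)
    (Ψ' : U₁ ≌ U₂) (A₁ : U₁)
    (placeMap : Places ((arithRealification hΦ₁).ops.base.obj (u₁.obj A₁)).L ≃
      Places ((arithRealification hΦ₂).ops.base.obj (u₂.obj (Ψ'.functor.obj A₁))).L)
    (θ : Perfection (Multiplicative (EffArithDivisor ((arithRealification hΦ₁).ops.base.obj (u₁.obj A₁)).L)) ≃*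
      Perfection (Multiplicative (EffArithDivisor
        ((arithRealification hΦ₂).ops.base.obj (u₂.obj (Ψ'.functor.obj A₁))).L)))
    (hθ : ∀ v, Primes.congr θ (Quotient.mk (primarySetoid _) ⟨_, EffArithDivisor.isPrimary_of_single _ v⟩) =
      Quotient.mk (primarySetoid _) ⟨_, EffArithDivisor.isPrimary_of_single _ (placeMap v)⟩)
    (hA' : (arithRealification hΦ₂).ops.IsFrobeniusTrivial
      (Ψrlf.functor.obj ⟨(arithRealification hΦ₁).ops.base.obj (u₁.obj A₁), 1⟩))
    (hdeg : ∀ x : Perfection (Multiplicative (EffArithDivisor ((arithRealification hΦ₁).ops.base.obj (u₁.obj A₁)).L)),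
      (arithRealification hΦ₂).δ _ hA'
          (picMap ⟨(arithRealification hΦ₁).ops.base.obj (u₁.obj A₁), 1⟩
            (Additive.ofMul (QuotientGroup.mk' _ (Algebra.GrothendieckGroup.of
              ((PreFrobenioid.IsPerfFactorialOn.op hΦ₁ (op ((arithRealification hΦ₁).ops.base.obj
                (u₁.obj A₁)))).toRealification x))))) =
        ((Multiplicative.toAdd (ArithRlfPic.rlfDegree hΦ₂
            ((arithRealification hΦ₂).ops.base.obj (u₂.obj (Ψ'.functor.obj A₁)))
            ((PreFrobenioid.IsPerfFactorialOn.op hΦ₂ (op ((arithRealification hΦ₂).ops.base.obj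
              (u₂.obj (Ψ'.functor.obj A₁))))).toRealification (θ x))) : ℝ≥0) : ℝ)) :
    Thm64iii (arithRealification hΦ₁) (arithRealification hΦ₂) Ψrlf picMap deg u₁ u₂ Ψ' A₁ placeMap := by
  -- the Frobenius-trivial object `(L₁, 0)` of `C₁^rlf`
  have hA : (arithRealification hΦ₁).ops.IsFrobeniusTrivial
      (⟨(arithRealification hΦ₁).ops.base.obj (u₁.obj A₁), 1⟩ : PreFrobenioid.rlf
        (ModelFrobenioid.toElem (arithDivisorFunctor F₁ K₁) (unitsFunctor F₁ K₁) (divNatTrans F₁ K₁)) hΦ₁) :=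
    arithRealification_isFrobeniusTrivial_zero hΦ₁ _
  intro hT h1
  -- the two degrees on the perfections, read in `ℝ`: `d_i := d_{L_i} ∘ ι_i^{pf→rlf}`
  refine thm64iii_of_primeTransport (arithRealification hΦ₁) (arithRealification hΦ₂) Ψrlf picMap deg u₁ u₂ Ψ' A₁
    placeMap θ hθ
    ((NNReal.toRealHom.toAddMonoidHom.toMultiplicative : Multiplicative ℝ≥0 →* Multiplicative ℝ).comp
      ((ArithRlfPic.rlfDegree hΦ₁ ((arithRealification hΦ₁).ops.base.obj (u₁.obj A₁))).comp
        (PreFrobenioid.IsPerfFactorialOn.op hΦ₁ (op ((arithRealification hΦ₁).ops.base.obj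
          (u₁.obj A₁)))).toRealification))
    ((NNReal.toRealHom.toAddMonoidHom.toMultiplicative : Multiplicative ℝ≥0 →* Multiplicative ℝ).comp
      ((ArithRlfPic.rlfDegree hΦ₂ ((arithRealification hΦ₂).ops.base.obj (u₂.obj (Ψ'.functor.obj A₁)))).comp
        (PreFrobenioid.IsPerfFactorialOn.op hΦ₂ (op ((arithRealification hΦ₂).ops.base.obj
          (u₂.obj (Ψ'.functor.obj A₁))))).toRealification))
    (fun D => ArithRlfPic.rlfDegree_iota hΦ₁ _ D) (fun D => ArithRlfPic.rlfDegree_iota hΦ₂ _ D) (fun x => ?_) hT h1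
  -- the degree compatibility for THIS `deg`: the antecedent at `((L₁,0), Ψrlf (L₁,0))` on the class `[ι₁ x]`
  have h4 := hT.2 ⟨(arithRealification hΦ₁).ops.base.obj (u₁.obj A₁), 1⟩ hA hA'
    (Additive.ofMul (QuotientGroup.mk' _ (Algebra.GrothendieckGroup.of
      ((PreFrobenioid.IsPerfFactorialOn.op hΦ₁ (op ((arithRealification hΦ₁).ops.base.obj
        (u₁.obj A₁)))).toRealification x))))
  -- `δ_{(L₁,0)}[ι₁ x] = d_{L₁}(ι₁ x)` (abc-iut-L1-d2)
  have h5 := arithRealification_δ_ofMul_mk_of hΦ₁ ⟨(arithRealification hΦ₁).ops.base.obj (u₁.obj A₁), 1⟩ hA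
    ((PreFrobenioid.IsPerfFactorialOn.op hΦ₁ (op ((arithRealification hΦ₁).ops.base.obj
      (u₁.obj A₁)))).toRealification x)
  -- (no `rw` here: keyed abstraction over these terms is too expensive; compose the three equalities directly)
  exact (hdeg x).symm.trans (h4.trans (congrArg (fun r : ℝ => deg * r) h5))

/-- **The same with THE `placeMap` produced inside** (existential form for the assembler's knit
`∀ A₁, ∃ placeMap, ∀ deg, Thm64iii …`): for every `deg`, granted the degree reading `hdeg`.
[cite: MochizukiFrdI2008, Thm. 6.4 (iii) p.116] -/
theorem exists_placeMap_thm64iii_arith_of_degreeReading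
    (Ψrlf : PreFrobenioid.rlf (ModelFrobenioid.toElem (arithDivisorFunctor F₁ K₁) (unitsFunctor F₁ K₁)
        (divNatTrans F₁ K₁)) hΦ₁ ≌
      PreFrobenioid.rlf (ModelFrobenioid.toElem (arithDivisorFunctor F₂ K₂) (unitsFunctor F₂ K₂)
        (divNatTrans F₂ K₂)) hΦ₂)
    (picMap : ∀ A, (arithRealification hΦ₁).Pic A ≃+ (arithRealification hΦ₂).Pic (Ψrlf.functor.obj A))
    {U₁ : Type} [Category.{0} U₁] {U₂ : Type} [Category.{0} U₂]
    (u₁ : U₁ ⥤ PreFrobenioid.rlf (ModelFrobenioid.toElem (arithDivisorFunctor F₁ K₁) (unitsFunctor F₁ K₁)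
      (divNatTrans F₁ K₁)) hΦ₁)
    (u₂ : U₂ ⥤ PreFrobenioid.rlf (ModelFrobenioid.toElem (arithDivisorFunctor F₂ K₂) (unitsFunctor F₂ K₂)
      (divNatTrans F₂ K₂)) hΦ₂)
    (Ψ' : U₁ ≌ U₂) (A₁ : U₁)
    (θ : Perfection (Multiplicative (EffArithDivisor ((arithRealification hΦ₁).ops.base.obj (u₁.obj A₁)).L)) ≃*
      Perfection (Multiplicative (EffArithDivisor
        ((arithRealification hΦ₂).ops.base.obj (u₂.obj (Ψ'.functor.obj A₁))).L)))
    (hA' : (arithRealification hΦ₂).ops.IsFrobeniusTrivial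
      (Ψrlf.functor.obj ⟨(arithRealification hΦ₁).ops.base.obj (u₁.obj A₁), 1⟩))
    (hdeg : ∀ x : Perfection (Multiplicative (EffArithDivisor ((arithRealification hΦ₁).ops.base.obj (u₁.obj A₁)).L)),
      (arithRealification hΦ₂).δ _ hA'
          (picMap ⟨(arithRealification hΦ₁).ops.base.obj (u₁.obj A₁), 1⟩
            (Additive.ofMul (QuotientGroup.mk' _ (Algebra.GrothendieckGroup.of
              ((PreFrobenioid.IsPerfFactorialOn.op hΦ₁ (op ((arithRealification hΦ₁).ops.base.obj
                (u₁.obj A₁)))).toRealification x))))) =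
        ((Multiplicative.toAdd (ArithRlfPic.rlfDegree hΦ₂
            ((arithRealification hΦ₂).ops.base.obj (u₂.obj (Ψ'.functor.obj A₁)))
            ((PreFrobenioid.IsPerfFactorialOn.op hΦ₂ (op ((arithRealification hΦ₂).ops.base.obj
              (u₂.obj (Ψ'.functor.obj A₁))))).toRealification (θ x))) : ℝ≥0) : ℝ)) :
    ∃ placeMap : Places ((arithRealification hΦ₁).ops.base.obj (u₁.obj A₁)).L ≃
        Places ((arithRealification hΦ₂).ops.base.obj (u₂.obj (Ψ'.functor.obj A₁))).L,
      (∀ v, Primes.congr θ (Quotient.mk (primarySetoid _) ⟨_, EffArithDivisor.isPrimary_of_single _ v⟩) =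
        Quotient.mk (primarySetoid _) ⟨_, EffArithDivisor.isPrimary_of_single _ (placeMap v)⟩) ∧
      ∀ deg : ℝ, Thm64iii (arithRealification hΦ₁) (arithRealification hΦ₂) Ψrlf picMap deg u₁ u₂ Ψ' A₁ placeMap := by
  obtain ⟨placeMap, hθ⟩ := exists_placeMap_of_pfTransport hΦ₁ hΦ₂ u₁ u₂ Ψ' A₁ θ
  exact ⟨placeMap, hθ, fun deg =>
    thm64iii_arith_of_degreeReading hΦ₁ hΦ₂ Ψrlf picMap deg u₁ u₂ Ψ' A₁ placeMap θ hθ hA' hdeg⟩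

end AtData

end Literature.AlgebraicGeometry.Frobenioids

end
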